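import Literature.Probability.RandomPlanarGeometry.SAWPulledPinning
import HarnessLib

/-!
# Pulled self-avoiding bridges ARE pinned by a penetrable defect line at `y = 2` (route R62, headline)

Topic `Literature/Probability/RandomPlanarGeometry` (continues `SAWPulledPinning.lean`). The conditional headline
`Zd.pulledPinning_two_of` fed with the tree's strip-deficit law at `y = 2`, `StripDeficit.stripDeficit_two.1`
(`∃ C T₀, StripDeficitUpper 2 C T₀`, computational lineage via the 18-memory certificate `checkC_18_2688`):
**for EVERY `β > 0` there are `g > 0` and `N₀` with `exp(N(λ_B(2) + g)) ≤ Z^{pin}_N(2, β)` for all `N ≥ N₀`** —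
`liminf N⁻¹ log Z^{pin}_N(2, β) > λ_B(2)`, i.e. `β_c^{pen}(y = 2) = 0` for the pulled self-avoiding bridge on `ℤ²`, with
the explicit gain `g = β/(24 W(β))`, `W(β) = max(T₀, 1, ⌈4C/β⌉)` (`g ≥ β²/(96C + 24β)` for `β ≤ 4C/T₀`).
**Printed status / label of record** (lit-1 g7 cell (α), lead g8 r23, 2026-08-22): FIRST pinning theorem for the
self-avoiding walk itself (pulled, `d = 2`) at a PENETRABLE defect line: trivial threshold with an explicit QUADRATIC gain
`g ≥ β²/(96C + 24β)`, from the certified strip-confinement law R51 (`SAWStripDeficit`, p329996) by pigeonhole on strip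
columns + hook surgery — not Ornstein–Zernike; printed analogues with the same `d = 2` quadratic shape: Friedli–Ioffe–Velenik
2013 Thm 1.1 (subcritical percolation with a line of defects) [cite: FriedliIoffeVelenik2013, Theorem 1.1], Ott–Velenik 2018
(FK–Potts) [cite: OttVelenik2018, §1], Giacomin 2011 Thm 2.7/2.10 (effective (1+1) renewal pinning, α = ½)
[cite: Giacomin2011, Theorem 2.7 and Theorem 2.10]; the unforced penetrable adsorption point `β_c^P = 0` of SAW remains OPEN
[cite: Madras2017, p. 3] (Beaton 2014 arXiv:1408.6880 withdrawn).
Lane «pcv-sawmu», route R62 (planner a-idea-1 `Sketch_G12`); seat a-p1 gen 5, 2026-08-22.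
[cite: IoffeVelenik2008, §3; MadrasSlade1993, §8.2]
-/

noncomputable section

namespace Literature.Probability.RandomPlanarGeometry.SAW.Zd

open StripDeficit

/-- **«PULLED-PINNING» at `y = 2`** (planner headline, verbatim): for every `β > 0` the pulled self-avoiding bridge on
`ℤ²` is pinned by the penetrable defect line `x₁ = 0` — there are `g > 0`, `N₀` with
`exp(N(λ_B(2) + g)) ≤ Z^{pin}_N(2, β)` for all `N ≥ N₀`. [cite: IoffeVelenik2008, §3; MadrasSlade1993, §8.2, Theorem 8.2.1] -/
theorem pulledPinning_two : ∀ β : ℝ, 0 < β → ∃ g : ℝ, 0 < g ∧ ∃ N₀ : ℕ, ∀ N : ℕ, N₀ ≤ N →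
      Real.exp ((N : ℝ) * (pulledBridgeFreeEnergy 2 2 + g)) ≤ pinZ N 2 β :=
  pulledPinning_two_of stripDeficit_two.1

end Literature.Probability.RandomPlanarGeometry.SAW.Zd

end
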